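import Literature.Geometry.Lorentzian.CoordMomentumConstraintAdjoint
import Literature.Geometry.Lorentzian.CoordRicciWaveGauge
import HarnessLib

/-!
# The momentum constraint as a smooth function of first jets

Generic coordinate calculus (`MetricCoord`, any finite-dimensional real normed space `E` with a
basis `b`), in support of the nonlinear remainder estimate in Step S5 of Li–Mei's interior Kerr
gluing (`InteriorKerrGluingReduction.lean`; J. Li, H. Mei, arXiv:2005.01249, Prop. 4.1): the
chart momentum constraint `M(G, K)(x)(Z) = momFn b G K x Z` (Bartnik–Isenberg 2004, (2.2)) is,
on the domain of the metric, the value of an explicit **smooth function of the first jets**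
`J = (G(x), DG(x), K(x), DK(x))`:

* `MetricCoord.Jet E` — the jet space `Sym-ish × (E →L Sym-ish) × Sym-ish × (E →L Sym-ish)`
  (`Sym-ish = E →L E →L ℝ`, no symmetry imposed);
* `MetricCoord.cov₂Of`, `mtrOf` — the covariant derivative of a bilinear form and the metric trace
  as functions of jets (`rfl`-lemmas `cov₂At_eq_cov₂Of`, `mtrAt_eq_mtrOf`), next to the existing
  `sharpOf`, `ginvOf`, `chrOf` of `CoordRicciWaveGauge.lean`;
* `MetricCoord.momOf b Z J` and **`IsMetricOn.momFn_eq_momOf`**: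
  `momFn b G K x Z = momOf b Z (jetAt G K x)` on `V` (via `∂_Z tr_G K = tr_G ∇_Z K`,
  `IsMetricOn.fderiv_mtrAt`);
* **`MetricCoord.contDiffAt_momOf₂`** — `(Z, J) ↦ momOf b Z J` is `C^∞` at every `J` whose metric
  component `J.1` is invertible (the inverse is analytic on invertible maps); `contDiffAt_momOf`;
* `MetricCoord.jetAt_add`, `jetAt_smul`, `ContDiffOn.jetAt` — jets are additive and smooth;
* **`IsMetricOn.fderiv_momOf_jetAt`** — `D(momOf b Z)(J(G₀,K₀)(x))(J(γ,κ)(x)) =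
  linMomFn b G₀ K₀ γ κ x Z`: the derivative of the jet function along jets of a smooth symmetric
  variation IS the linearised momentum constraint (`hasDerivWithinAt_momFn_linMomFn` along the
  segment family `G₀ + sγ`, `IsMetricOn.exists_segment_invertible`).

Consequently the second-order Taylor remainder of `M` in the jets is uniformly `O(|ΔJ|²)` on
compact jet sets (`LiMei.exists_norm_taylor₂_le_parametric`), which is the pointwise form of
Li–Mei's `𝓘 = L p + e + O(ε²)` for the nonlinear part. Everything here is folklore multivariable
calculus; no named facts.

## References

* R. Bartnik, J. Isenberg, *The constraint equations*, Birkhäuser 2004, §2, (2.2).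
  [BartnikIsenberg2004]
* J. Li, H. Mei, arXiv:2005.01249, §4, proof of Prop. 4.1, p. 25. [LiMei2020]
-/

noncomputable section

set_option maxSynthPendingDepth 3

open Set Filter ContinuousLinearMap Module
open scoped Topology ContDiff

namespace Literature.Geometry.Lorentzian

namespace MetricCoord

variable {E : Type*} [NormedAddCommGroup E] [NormedSpace ℝ E]

/-! ### Jet-level versions of `Γ`, `∇β`, `tr_G`, `g^{ij}` -/

section JetDefs

/-- The space of first jets `(G(x), DG(x), K(x), DK(x))` of a pair of fields of bilinear forms.
[folklore] -/
abbrev Jet (E : Type*) [NormedAddCommGroup E] [NormedSpace ℝ E] :=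
  (E →L[ℝ] E →L[ℝ] ℝ) × (E →L[ℝ] E →L[ℝ] E →L[ℝ] ℝ) × (E →L[ℝ] E →L[ℝ] ℝ) ×
    (E →L[ℝ] E →L[ℝ] E →L[ℝ] ℝ)

/-- The covariant derivative of a bilinear form as a function of `(B, B') = (β(x), Dβ(x))` and of
the Christoffel map `Γ`: `B' − B(Γ·, ·) − B(·, Γ·)`. [folklore] -/
def cov₂Of (B : E →L[ℝ] E →L[ℝ] ℝ) (B' : E →L[ℝ] E →L[ℝ] E →L[ℝ] ℝ) (Γ : E →L[ℝ] E →L[ℝ] E) :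
    E →L[ℝ] E →L[ℝ] E →L[ℝ] ℝ :=
  B' - (ContinuousLinearMap.compL ℝ E E (E →L[ℝ] ℝ) B).comp Γ
    - flipCLM.comp ((ContinuousLinearMap.compL ℝ E E (E →L[ℝ] ℝ) (flipCLM B)).comp Γ)

/-- `(∇β)_x = cov₂Of (β x) (Dβ x) Γ_x`. [folklore] -/
theorem cov₂At_eq_cov₂Of (G β : E → E →L[ℝ] E →L[ℝ] ℝ) (x : E) :
    cov₂At G β x = cov₂Of (β x) (fderiv ℝ β x) (chrAt G x) := rfl

/-- The metric trace as a function of `A = G(x)`: `tr (♯_A ∘ β)`. [folklore] -/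
def mtrOf (A β : E →L[ℝ] E →L[ℝ] ℝ) : ℝ :=
  LinearMap.trace ℝ E ((A.inverse.comp β : E →L[ℝ] E) : E →ₗ[ℝ] E)

/-- `tr_G β (x) = mtrOf (G x) β`. [folklore] -/
theorem mtrAt_eq_mtrOf (G : E → E →L[ℝ] E →L[ℝ] ℝ) (x : E) (β : E →L[ℝ] E →L[ℝ] ℝ) :
    mtrAt G x β = mtrOf (G x) β := rfl

variable {ι : Type*} [Fintype ι] [FiniteDimensional ℝ E] (b : Basis ι ℝ E)

/-- `mtrOf` through the continuous trace. [folklore] -/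
theorem mtrOf_eq_traceCLM (A β : E →L[ℝ] E →L[ℝ] ℝ) :
    mtrOf A β = traceCLM E (A.inverse.comp β) := rfl

/-- The first jet of a pair of fields at a point. [folklore] -/
def jetAt (G K : E → E →L[ℝ] E →L[ℝ] ℝ) (x : E) : Jet E := (G x, fderiv ℝ G x, K x, fderiv ℝ K x)

/-- **The momentum constraint as a function of first jets**:
`Σ_{kl} g^{kl} (∇K)(b_k; b_l, Z) − tr_G (∇_Z K)`. [cite: BartnikIsenberg2004, (2.2)] -/
def momOf (Z : E) (J : Jet E) : ℝ :=
  ∑ k, ∑ l, ginvOf b J.1 k l * cov₂Of J.2.2.1 J.2.2.2 (chrOf J.1 J.2.1) (b k) (b l) Z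
    - mtrOf J.1 (cov₂Of J.2.2.1 J.2.2.2 (chrOf J.1 J.2.1) Z)

omit [FiniteDimensional ℝ E] in
/-- Jets are additive (at points of differentiability). [folklore] -/
theorem jetAt_add {G γ K κ : E → E →L[ℝ] E →L[ℝ] ℝ} {x : E} (hG : DifferentiableAt ℝ G x)
    (hγ : DifferentiableAt ℝ γ x) (hK : DifferentiableAt ℝ K x) (hκ : DifferentiableAt ℝ κ x) :
    jetAt (G + γ) (K + κ) x = jetAt G K x + jetAt γ κ x := by
  simp only [jetAt, Prod.mk_add_mk, Pi.add_apply]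
  rw [(hG.hasFDerivAt.add hγ.hasFDerivAt).fderiv, (hK.hasFDerivAt.add hκ.hasFDerivAt).fderiv]

omit [FiniteDimensional ℝ E] in
/-- Jets scale. [folklore] -/
theorem jetAt_smul {γ κ : E → E →L[ℝ] E →L[ℝ] ℝ} {x : E} (hγ : DifferentiableAt ℝ γ x)
    (hκ : DifferentiableAt ℝ κ x) (s : ℝ) :
    jetAt (s • γ) (s • κ) x = s • jetAt γ κ x := by
  simp only [jetAt, Prod.smul_mk, Pi.smul_apply]
  rw [(hγ.hasFDerivAt.const_smul s).fderiv, (hκ.hasFDerivAt.const_smul s).fderiv]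

omit [FiniteDimensional ℝ E] in
/-- Jets of smooth fields are smooth. [folklore] -/
theorem _root_.ContDiffOn.jetAt {G K : E → E →L[ℝ] E →L[ℝ] ℝ} {V : Set E} (hV : IsOpen V)
    (hG : ContDiffOn ℝ ∞ G V) (hK : ContDiffOn ℝ ∞ K V) : ContDiffOn ℝ ∞ (jetAt G K) V :=
  hG.prodMk ((hG.fderiv_of_isOpen hV (by simp)).prodMk
    (hK.prodMk (hK.fderiv_of_isOpen hV (by simp))))

end JetDefs

/-! ### `M = momOf ∘ jets` and smoothness of `momOf` -/

section Mom

variable [CompleteSpace E] {ι : Type*} [Fintype ι] [FiniteDimensional ℝ E] (b : Basis ι ℝ E)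
  {G K : E → E →L[ℝ] E →L[ℝ] ℝ} {V : Set E} {x : E}

/-- **`M(G,K)(x)(Z) = momOf b Z (G(x), DG(x), K(x), DK(x))`** on the domain of the metric, for
`K` differentiable at `x` (`∂_Z tr_G K = tr_G ∇_Z K`). [cite: BartnikIsenberg2004, (2.2)] -/
theorem IsMetricOn.momFn_eq_momOf (hG : IsMetricOn G V) (hx : x ∈ V) (hK : DifferentiableAt ℝ K x)
    (Z : E) : momFn b G K x Z = momOf b Z (jetAt G K x) := by
  rw [momFn_eq, hG.fderiv_mtrAt hx hK Z]
  rfl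

omit [CompleteSpace E] in
/-- Unfolding of `momOf` through `traceCLM` and `coordCLM`. [folklore] -/
theorem momOf_eq (Z : E) (J : Jet E) :
    momOf b Z J = ∑ k, ∑ l, coordCLM b k (J.1.inverse (coordCLM b l)) *
        cov₂Of J.2.2.1 J.2.2.2 (chrOf J.1 J.2.1) (b k) (b l) Z
      - traceCLM E (J.1.inverse.comp (cov₂Of J.2.2.1 J.2.2.2 (chrOf J.1 J.2.1) Z)) := rfl

/-- **`(Z, J) ↦ momOf b Z J` is smooth at every jet with invertible metric component.**
[folklore] -/
theorem contDiffAt_momOf₂ {q₀ : E × Jet E} (hq : q₀.2.1.IsInvertible) :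
    ContDiffAt ℝ ∞ (fun q : E × Jet E ↦ momOf b q.1 q.2) q₀ := by
  -- the coordinate projections
  have hA : ContDiff ℝ ∞ (fun q : E × Jet E ↦ q.2.1) := contDiff_fst.comp contDiff_snd
  have hA' : ContDiff ℝ ∞ (fun q : E × Jet E ↦ q.2.2.1) :=
    contDiff_fst.comp (contDiff_snd.comp contDiff_snd)
  have hB : ContDiff ℝ ∞ (fun q : E × Jet E ↦ q.2.2.2.1) :=
    contDiff_fst.comp (contDiff_snd.comp (contDiff_snd.comp contDiff_snd))
  have hB' : ContDiff ℝ ∞ (fun q : E × Jet E ↦ q.2.2.2.2) :=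
    contDiff_snd.comp (contDiff_snd.comp (contDiff_snd.comp contDiff_snd))
  -- the inverse of the metric component
  have hinv : ContDiffAt ℝ ∞ (fun q : E × Jet E ↦ q.2.1.inverse) q₀ :=
    (hq.contDiffAt_map_inverse.comp q₀ hA.contDiffAt :)
  -- the Christoffel map
  have hchr : ContDiffAt ℝ ∞ (fun q : E × Jet E ↦ chrOf q.2.1 q.2.2.1) q₀ := by
    have h1 : ContDiffAt ℝ ∞
        (fun q : E × Jet E ↦ ContinuousLinearMap.compL ℝ E (E →L[ℝ] ℝ) E q.2.1.inverse) q₀ :=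
      (ContinuousLinearMap.contDiff _).contDiffAt.comp q₀ hinv
    have h2 : ContDiffAt ℝ ∞ (fun q : E × Jet E ↦ koszulOp q.2.2.1) q₀ :=
      (ContinuousLinearMap.contDiff _).contDiffAt.comp q₀ hA'.contDiffAt
    exact (h1.clm_comp h2).const_smul (2⁻¹ : ℝ)
  -- the covariant derivative of `K`
  have hcov : ContDiffAt ℝ ∞
      (fun q : E × Jet E ↦ cov₂Of q.2.2.2.1 q.2.2.2.2 (chrOf q.2.1 q.2.2.1)) q₀ := by
    have h1 : ContDiffAt ℝ ∞
        (fun q : E × Jet E ↦ ContinuousLinearMap.compL ℝ E E (E →L[ℝ] ℝ) q.2.2.2.1) q₀ :=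
      (ContinuousLinearMap.contDiff _).contDiffAt.comp q₀ hB.contDiffAt
    have h2 : ContDiffAt ℝ ∞
        (fun q : E × Jet E ↦ ContinuousLinearMap.compL ℝ E E (E →L[ℝ] ℝ) (flipCLM q.2.2.2.1)) q₀ :=
      (ContinuousLinearMap.contDiff _).contDiffAt.comp q₀
        ((ContinuousLinearMap.contDiff _).contDiffAt.comp q₀ hB.contDiffAt)
    have h3 : ContDiffAt ℝ ∞ (fun q : E × Jet E ↦
        flipCLM.comp ((ContinuousLinearMap.compL ℝ E E (E →L[ℝ] ℝ) (flipCLM q.2.2.2.1)).comp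
          (chrOf q.2.1 q.2.2.1))) q₀ :=
      contDiffAt_const.clm_comp (h2.clm_comp hchr)
    exact (hB'.contDiffAt.sub (h1.clm_comp hchr)).sub h3
  -- the pieces of `momOf`
  have hterm : ∀ k l, ContDiffAt ℝ ∞ (fun q : E × Jet E ↦
      coordCLM b k (q.2.1.inverse (coordCLM b l)) *
        cov₂Of q.2.2.2.1 q.2.2.2.2 (chrOf q.2.1 q.2.2.1) (b k) (b l) q.1) q₀ := by
    intro k l
    refine ((ContinuousLinearMap.contDiff _).contDiffAt.comp q₀
      (hinv.clm_apply contDiffAt_const)).mul ?_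
    exact ((hcov.clm_apply contDiffAt_const).clm_apply contDiffAt_const).clm_apply contDiffAt_fst
  have htr : ContDiffAt ℝ ∞ (fun q : E × Jet E ↦
      traceCLM E (q.2.1.inverse.comp (cov₂Of q.2.2.2.1 q.2.2.2.2 (chrOf q.2.1 q.2.2.1) q.1))) q₀ :=
    (ContinuousLinearMap.contDiff _).contDiffAt.comp q₀
      (hinv.clm_comp (hcov.clm_apply contDiffAt_fst))
  have hsum : ContDiffAt ℝ ∞ (fun q : E × Jet E ↦ ∑ k, ∑ l,
      coordCLM b k (q.2.1.inverse (coordCLM b l)) *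
        cov₂Of q.2.2.2.1 q.2.2.2.2 (chrOf q.2.1 q.2.2.1) (b k) (b l) q.1) q₀ :=
    ContDiffAt.sum fun k _ ↦ ContDiffAt.sum fun l _ ↦ hterm k l
  exact (hsum.sub htr).congr_of_eventuallyEq (Eventually.of_forall fun q ↦ momOf_eq b q.1 q.2)

/-- `momOf b Z` is smooth at every jet with invertible metric component. [folklore] -/
theorem contDiffAt_momOf (Z : E) {J : Jet E} (hJ : J.1.IsInvertible) :
    ContDiffAt ℝ ∞ (momOf b Z) J :=
  (contDiffAt_momOf₂ b (q₀ := (Z, J)) hJ).comp J (contDiffAt_const.prodMk contDiffAt_id)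

omit [CompleteSpace E] in
/-- `momOf b Z J` is linear in `Z`: additivity. [folklore] -/
theorem momOf_add_arg (Z₁ Z₂ : E) (J : Jet E) :
    momOf b (Z₁ + Z₂) J = momOf b Z₁ J + momOf b Z₂ J := by
  simp only [momOf_eq, map_add, ContinuousLinearMap.comp_add, mul_add, Finset.sum_add_distrib]
  ring

omit [CompleteSpace E] in
/-- `momOf b Z J` is linear in `Z`: homogeneity. [folklore] -/
theorem momOf_smul_arg (c : ℝ) (Z : E) (J : Jet E) :
    momOf b (c • Z) J = c * momOf b Z J := by
  simp only [momOf_eq, map_smul, ContinuousLinearMap.comp_smul, smul_eq_mul]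
  rw [mul_sub, Finset.mul_sum]
  congr 1
  refine Finset.sum_congr rfl fun k _ ↦ ?_
  rw [Finset.mul_sum]
  exact Finset.sum_congr rfl fun l _ ↦ by ring

end Mom

/-! ### The derivative of `momOf` along jets of fields is the linearised momentum constraint -/

section Identification

variable [CompleteSpace E] {ι : Type*} [Fintype ι] [FiniteDimensional ℝ E] (b : Basis ι ℝ E)
  {G₀ K₀ γ κ : E → E →L[ℝ] E →L[ℝ] ℝ} {V : Set E} {x : E}

omit [FiniteDimensional ℝ E] in
/-- **Local invertibility along the segment**: near `(0, x)` the forms `G₀(y) + s γ(y)` stay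
invertible. [folklore] -/
theorem IsMetricOn.exists_segment_invertible (hG : IsMetricOn G₀ V) (hγ : ContDiffOn ℝ ∞ γ V)
    (hx : x ∈ V) :
    ∃ η : ℝ, 0 < η ∧ ∃ V' : Set E, IsOpen V' ∧ x ∈ V' ∧ V' ⊆ V ∧
      ∀ s ∈ Ioo (-η) η, ∀ y ∈ V', (G₀ y + s • γ y).IsInvertible := by
  obtain ⟨e, he⟩ := hG.isInvertible x hx
  have hO : range ((↑) : (E ≃L[ℝ] (E →L[ℝ] ℝ)) → E →L[ℝ] (E →L[ℝ] ℝ)) ∈ 𝓝 (G₀ x + (0 : ℝ) • γ x) := by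
    rw [zero_smul, add_zero, ← he]
    exact e.nhds
  have hφ : ContinuousAt (fun q : ℝ × E ↦ G₀ q.2 + q.1 • γ q.2) (0, x) := by
    have hG₀ : ContinuousAt G₀ x := (hG.contDiffOn.continuousOn.continuousWithinAt hx).continuousAt
      (hG.isOpen.mem_nhds hx)
    have hγ₀ : ContinuousAt γ x := (hγ.continuousOn.continuousWithinAt hx).continuousAt
      (hG.isOpen.mem_nhds hx)
    exact (hG₀.comp_of_eq continuousAt_snd rfl).add
      (continuousAt_fst.smul (hγ₀.comp_of_eq continuousAt_snd rfl))
  have hpre := hφ.preimage_mem_nhds hO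
  obtain ⟨u, hu, v, hv, huv⟩ := mem_nhds_prod_iff.1 hpre
  obtain ⟨η, hη, hηu⟩ := Metric.mem_nhds_iff.1 hu
  refine ⟨η, hη, interior (v ∩ V), isOpen_interior, ?_, interior_subset.trans inter_subset_right,
    fun s hs y hy ↦ ?_⟩
  · exact mem_interior_iff_mem_nhds.2 (inter_mem hv (hG.isOpen.mem_nhds hx))
  · have hsu : s ∈ u := hηu (by simpa [Real.ball_eq_Ioo] using hs)
    obtain ⟨e', he'⟩ := huv (mk_mem_prod hsu (interior_subset hy).1)
    exact ⟨e', he'⟩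

/-- **`D(momOf)(J(G₀,K₀))(J(γ,κ)) = DM_{(G₀,K₀)}(γ, κ)`**: the derivative of the jet function of
the momentum constraint along the jets of a smooth symmetric variation `(γ, κ)` is the linearised
momentum constraint `linMomFn` (differentiate `s ↦ M(G₀ + sγ, K₀ + sκ)(x)` at `s = 0` through
`momFn_eq_momOf` and through `hasDerivWithinAt_momFn_linMomFn`).
[cite: BartnikIsenberg2004, (2.2)] -/
theorem IsMetricOn.fderiv_momOf_jetAt (hG : IsMetricOn G₀ V) (hK : ContDiffOn ℝ ∞ K₀ V)
    (hγ : ContDiffOn ℝ ∞ γ V) (hγs : ∀ y ∈ V, ∀ v w, γ y v w = γ y w v) (hκ : ContDiffOn ℝ ∞ κ V)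
    (hx : x ∈ V) (Z : E) :
    fderiv ℝ (momOf b Z) (jetAt G₀ K₀ x) (jetAt γ κ x) = linMomFn b G₀ K₀ γ κ x Z := by
  obtain ⟨η, hη, V', hV'o, hxV', hV'V, hinv⟩ := hG.exists_segment_invertible hγ hx
  set S : Set ℝ := Ioo (-η) η with hS
  have hS0 : (0 : ℝ) ∈ S := by rw [hS]; exact ⟨by linarith, hη⟩
  have hSo : IsOpen S := isOpen_Ioo
  -- the segment families
  set Gf : ℝ → E → E →L[ℝ] E →L[ℝ] ℝ := fun s ↦ G₀ + s • γ with hGf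
  set Kf : ℝ → E → E →L[ℝ] E →L[ℝ] ℝ := fun s ↦ K₀ + s • κ with hKf
  have hGV' := hG.contDiffOn.mono hV'V
  have hγV' := hγ.mono hV'V
  have hKV' := hK.mono hV'V
  have hκV' := hκ.mono hV'V
  have hfam : IsMetricFamilyOn Gf S V' := by
    refine ⟨fun s hs ↦ ⟨hV'o, ?_, ?_, fun y hy ↦ ?_⟩, ?_, uniqueDiffOn_Ioo _ _, ?_⟩
    · exact hGV'.add (contDiffOn_const.smul hγV')
    · intro y hy v w
      change G₀ y v w + s • γ y v w = G₀ y w v + s • γ y w v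
      rw [hG.symm y (hV'V hy) v w, hγs y (hV'V hy) v w]
    · simpa only [hGf, Pi.add_apply, Pi.smul_apply] using hinv s hs y hy
    · have h1 : ContDiffOn ℝ ∞ (fun p : E × ℝ ↦ G₀ p.1) (V' ×ˢ S) :=
        hGV'.comp contDiffOn_fst fun p hp ↦ hp.1
      have h2 : ContDiffOn ℝ ∞ (fun p : E × ℝ ↦ γ p.1) (V' ×ˢ S) :=
        hγV'.comp contDiffOn_fst fun p hp ↦ hp.1
      exact (h1.add (contDiffOn_snd.smul h2)).congr fun p _ ↦ by
        simp only [hGf, Pi.add_apply, Pi.smul_apply]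
        rfl
    · rw [hSo.interior_eq]
      exact subset_closure
  have hKfam : ContDiffOn ℝ ∞ (fun p : E × ℝ ↦ Kf p.2 p.1) (V' ×ˢ S) := by
    have h1 : ContDiffOn ℝ ∞ (fun p : E × ℝ ↦ K₀ p.1) (V' ×ˢ S) :=
      hKV'.comp contDiffOn_fst fun p hp ↦ hp.1
    have h2 : ContDiffOn ℝ ∞ (fun p : E × ℝ ↦ κ p.1) (V' ×ˢ S) :=
      hκV'.comp contDiffOn_fst fun p hp ↦ hp.1
    exact (h1.add (contDiffOn_snd.smul h2)).congr fun p _ ↦ by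
      simp only [hKf, Pi.add_apply, Pi.smul_apply]
      rfl
  -- the first variation along the family
  have hvar := hfam.hasDerivWithinAt_momFn_linMomFn b hKfam hxV' hS0 Z
  have hG0 : Gf 0 = G₀ := by simp only [hGf, zero_smul, add_zero]
  have hK0 : Kf 0 = K₀ := by simp only [hKf, zero_smul, add_zero]
  have htG : tDeriv Gf S 0 = γ := by
    funext y
    rw [tDeriv, derivWithin_of_isOpen hSo hS0]
    simp only [hGf, Pi.add_apply, Pi.smul_apply]
    rw [(((hasDerivAt_id' (0 : ℝ)).smul_const (γ y)).const_add (G₀ y)).deriv, one_smul]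
  have htK : tDeriv Kf S 0 = κ := by
    funext y
    rw [tDeriv, derivWithin_of_isOpen hSo hS0]
    simp only [hKf, Pi.add_apply, Pi.smul_apply]
    rw [(((hasDerivAt_id' (0 : ℝ)).smul_const (κ y)).const_add (K₀ y)).deriv, one_smul]
  rw [hG0, hK0, htG, htK] at hvar
  -- the same function through `momOf ∘ jets`
  set J₀ := jetAt G₀ K₀ x with hJ₀
  set ΔJ := jetAt γ κ x with hΔJ
  have hxn : V ∈ 𝓝 x := hG.isOpen.mem_nhds hx
  have hdG : DifferentiableAt ℝ G₀ x := (hG.contDiffOn.contDiffAt hxn).differentiableAt (by simp)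
  have hdK : DifferentiableAt ℝ K₀ x := (hK.contDiffAt hxn).differentiableAt (by simp)
  have hdγ : DifferentiableAt ℝ γ x := (hγ.contDiffAt hxn).differentiableAt (by simp)
  have hdκ : DifferentiableAt ℝ κ x := (hκ.contDiffAt hxn).differentiableAt (by simp)
  have hjet : ∀ s : ℝ, jetAt (Gf s) (Kf s) x = J₀ + s • ΔJ := by
    intro s
    simp only [hGf, hKf, hJ₀, hΔJ]
    rw [jetAt_add hdG (hdγ.const_smul s) hdK (hdκ.const_smul s), jetAt_smul hdγ hdκ s]
  have heq : ∀ s ∈ S, momOf b Z (J₀ + s • ΔJ) = momFn b (Gf s) (Kf s) x Z := by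
    intro s hs
    have hdKs : DifferentiableAt ℝ (Kf s) x := by
      simp only [hKf]
      exact hdK.add (hdκ.const_smul s)
    rw [(hfam.isMetricOn s hs).momFn_eq_momOf b hxV' hdKs Z, hjet s]
  have hJinv : J₀.1.IsInvertible := hG.isInvertible x hx
  have hψ : HasDerivAt (fun s : ℝ ↦ momOf b Z (J₀ + s • ΔJ))
      (fderiv ℝ (momOf b Z) J₀ ((1 : ℝ) • ΔJ)) 0 :=
    ((contDiffAt_momOf b Z hJinv).differentiableAt (by simp)).hasFDerivAt.comp_hasDerivAt_of_eq 0
      (((hasDerivAt_id' (0 : ℝ)).smul_const ΔJ).const_add J₀)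
      (by
        have h0 : (0 : ℝ) • ΔJ = 0 := zero_smul ℝ ΔJ
        change J₀ = J₀ + (0 : ℝ) • ΔJ
        rw [h0, add_zero])
  rw [one_smul] at hψ
  have hψ' : HasDerivWithinAt (fun s : ℝ ↦ momFn b (Gf s) (Kf s) x Z)
      (fderiv ℝ (momOf b Z) J₀ ΔJ) S 0 :=
    hψ.hasDerivWithinAt.congr (fun s hs ↦ (heq s hs).symm) (heq 0 hS0).symm
  have hU : UniqueDiffWithinAt ℝ S 0 := hSo.uniqueDiffWithinAt hS0
  rw [← hψ'.derivWithin hU, hvar.derivWithin hU]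

end Identification

end MetricCoord

end Literature.Geometry.Lorentzian

end
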